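import Summits.Ventures.CertifiedArithmetic.LowPrec.GemmThetaLawGenFinal
import Summits.Ventures.CertifiedArithmetic.LowPrec.GemmThetaE2M1

/-!
# Letter-dependent symbolic θ-certificates: two-sided envelopes and the binary32 instances

HONEST FRAMING (venture CertifiedArithmetic / cell `pub-lowprec`, seat gemm, gen 12 → 13): certified
error envelopes and provably optimal rounding/accumulation schemes for low-precision formats under
stated cost models; every table by two implementations; no hardware or vendor claims.

* `ThetaCertificate.abs_err_le`: for a symmetric alphabet, a θ-certificate bounds the error of
  sequential round-to-nearest-even accumulation two-sidedly:
  `|ŝ_m - Σ x| ≤ (1 - θ/(m + θ(1 + max ρ β_pair + κ)))·Σ|x|` for EVERY word and length (the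
  generic form of `abs_err_le_E2M1_prec`).
* The product alphabets are the laws' alphabets: every `E2M1·E2M1`, `E2M3·E2M1`, `E3M2·E2M1` product
  is a letter of `e2m1Law.PiL 2`, `e2m3e2m1Law.PiL 4`, `e3m2e2m1Law.PiL 5` (kernel, all pairs, through
  the law-generic magnitude test `PiL_of_magTest`: products of magnitudes in quanta against `0 :: X`).
* IEEE binary32 (`p = 24`) satisfies the format hypotheses of the three generated certificates; hence
  `abs_dot_err_le_e2m3e2m1_Binary32` and `abs_dot_err_le_e3m2e2m1_Binary32`: all-`n` envelopes of the
  mixed FP6×FP4 dot products accumulated sequentially in binary32, with the laws' constants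
  (`thetaL 23`, `rhoL`, `betaL`, `kappaL 23`, evaluated in `lawConstants_Binary32`); and, as a
  closing `example` (consistency check of the generator, not re-declared because the statement is
  verbatim gen 12's `abs_dot_err_le_E2M1_Binary32` of `GemmThetaLawE2M1.lean`), the E2M1² envelope
  `1 - 13631490/(8n + 170393625)` re-derived from the generated certificate `thetaCert_e2m1Law`.
-/

namespace Literature.ComputerArithmetic.FloatingPoint

namespace MiniFloat

open Finset

namespace ThetaCertificate

variable {α : Format} {Λ S : ℚ → Prop} {ψ : ℚ → ℚ} {θ ρ βp κ : ℚ}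

/-- TWO-SIDED ENVELOPE from a θ-certificate over a symmetric alphabet. [cell, gemm.tex Prop. Θ(i)] -/
theorem abs_err_le (hc : ThetaCertificate α Λ S ψ θ ρ βp κ) (hΛ : ∀ q, Λ q → Λ (-q))
    (x : ℕ → ℚ) (hx : ∀ j, Λ (x j)) (m : ℕ) :
    |(seqSum α x m).toRat - ∑ j ∈ range (m + 1), x j|
      ≤ (1 - θ / (m + θ * (1 + (max ρ βp + κ)))) * ∑ j ∈ range (m + 1), |x j| := by
  have hθ := hc.θ_pos
  have hB : 0 ≤ max ρ βp + κ := add_nonneg (le_max_of_le_left hc.ρ_nonneg) hc.κ_nonneg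
  by_cases hL : ∑ j ∈ range (m + 1), |x j| = 0
  · have hz : ∀ j ∈ range (m + 1), x j = 0 := by
      intro j hj
      have := (sum_eq_zero_iff_of_nonneg fun i _ => abs_nonneg (x i)).mp hL j hj
      exact abs_eq_zero.mp this
    have hs : ∀ k ≤ m, (seqSum α x k).toRat = 0 := by
      intro k hk
      induction k with
      | zero => simp [seqSum, hz 0 (by simp), toRat_roundNE_zero]
      | succ k ih =>
          simp only [seqSum]
          rw [ih (by omega), hz (k + 1) (mem_range.mpr (by omega)), add_zero, toRat_roundNE_zero]
    rw [hs m le_rfl, sum_eq_zero hz, hL]; simp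
  · have hpos : 0 < ∑ j ∈ range (m + 1), |x j| :=
      lt_of_le_of_ne (sum_nonneg fun i _ => abs_nonneg (x i)) (Ne.symm hL)
    have hden : 0 < (m : ℚ) + θ * (1 + (max ρ βp + κ)) := by
      have : (0 : ℚ) ≤ m := Nat.cast_nonneg m
      nlinarith
    have hc0 : (0 : ℚ) ≤ 1 - θ / (m + θ * (1 + (max ρ βp + κ))) := by
      rw [sub_nonneg, div_le_one hden]
      have : (0 : ℚ) ≤ m := Nat.cast_nonneg m
      nlinarith
    have h1 := hc.defect_bound x hx m hpos
    have hx' : ∀ j, Λ ((fun j => -x j) j) := fun j => hΛ _ (hx j)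
    have h2 := hc.defect_bound (fun j => -x j) hx' m (by simpa using hpos)
    simp only [abs_neg, sum_neg_distrib, toRat_seqSum_neg] at h2
    rw [abs_le]
    constructor
    · have := (le_sub_comm.mp h2)
      rw [div_le_iff₀ hpos] at this
      linarith
    · have := (le_sub_comm.mp h1)
      rw [div_le_iff₀ hpos] at this
      linarith

end ThetaCertificate

namespace ThetaLaw

/-- The signed alphabet `Λ` is symmetric. [cell] -/
theorem neg_mem_lam (L : LawData) {z : ℤ} (hz : z ∈ L.lam) : -z ∈ L.lam := by
  unfold LawData.lam at hz ⊢
  rcases List.mem_append.1 hz with h | h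
  · rcases List.mem_cons.1 h with rfl | h
    · exact List.mem_append.2 (Or.inl (List.mem_cons.2 (Or.inl (by simp))))
    · obtain ⟨x, hx, rfl⟩ := List.mem_map.1 h
      exact List.mem_append.2 (Or.inr (List.mem_map.2 ⟨x, hx, rfl⟩))
  · obtain ⟨x, hx, rfl⟩ := List.mem_map.1 h
    exact List.mem_append.2 (Or.inl (List.mem_cons.2 (Or.inr (List.mem_map.2 ⟨x, hx, by simp⟩))))

/-- The laws' alphabets are symmetric. [cell] -/
theorem PiL_neg (L : LawData) (G : ℕ) {q : ℚ} (h : L.PiL G q) : L.PiL G (-q) := by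
  obtain ⟨z, hz, rfl⟩ := h
  exact ⟨-z, neg_mem_lam L hz, by push_cast; ring⟩

/-- A Bool membership test for `PiL`. [cell] -/
theorem PiL_of_any (L : LawData) (G : ℕ) {q : ℚ}
    (h : (L.lam.any fun z => decide (q = (z : ℚ) / 2 ^ G)) = true) : L.PiL G q := by
  simp only [List.any_eq_true, decide_eq_true_eq] at h
  obtain ⟨z, hz, hq⟩ := h
  exact ⟨z, hz, hq⟩

/-- `0` and the letter magnitudes are letters of `Λ`. [cell] -/
theorem natCast_mem_lam (L : LawData) {n : ℕ} (hn : n ∈ 0 :: L.X) : (n : ℤ) ∈ L.lam := by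
  rcases List.mem_cons.1 hn with h0 | hX
  · subst h0; simp [LawData.lam]
  · simp [LawData.lam, hX]

/-- MAGNITUDE MEMBERSHIP TEST for product alphabets: if every product of the magnitudes (in
quanta) of two data is `0` or a letter magnitude of `L`, and the quanta of the two formats multiply
to `2^-G`, then every product of values is a letter of `L.PiL G` (kernel cost: pairs × `|X|`
natural-number comparisons, no rational arithmetic). [cell] -/
theorem PiL_of_magTest (L : LawData) (G : ℕ) {φ ψ : Format}
    (hG : φ.quantum * ψ.quantum = 1 / 2 ^ G)
    (h : ((all φ).all fun x => (all ψ).all fun y =>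
      decide (x.scaledMag * y.scaledMag ∈ 0 :: L.X)) = true)
    (a : MiniFloat φ) (b : MiniFloat ψ) : L.PiL G (a.toRat * b.toRat) := by
  have hz : ((a.scaledMag * b.scaledMag : ℕ) : ℤ) ∈ L.lam :=
    natCast_mem_lam L (of_decide_eq_true (forall₂_of_all_all h a b))
  have habs : (a.toInt * b.toInt).natAbs = a.scaledMag * b.scaledMag := by
    rw [Int.natAbs_mul, natAbs_toInt, natAbs_toInt]
  have hmem : a.toInt * b.toInt ∈ L.lam := by
    rcases Int.natAbs_eq (a.toInt * b.toInt) with h1 | h1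
    · rw [h1, habs]; exact hz
    · rw [h1, habs]; exact neg_mem_lam L hz
  refine ⟨_, hmem, ?_⟩
  simp only [toRat]
  rw [mul_mul_mul_comm, hG]
  push_cast
  ring

/-- The quanta of E2M1×E2M1, E2M3×E2M1, E3M2×E2M1 multiply to `2^-2`, `2^-4`, `2^-5`.
[cite: RouhaniEtAl2023MX, Table 1] -/
theorem quantum_pairs_e2m1 : Format.E2M1.quantum * Format.E2M1.quantum = 1 / 2 ^ 2 ∧
    Format.E2M3.quantum * Format.E2M1.quantum = 1 / 2 ^ 4 ∧
    Format.E3M2.quantum * Format.E2M1.quantum = 1 / 2 ^ 5 := by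
  rw [Format.E2M1_maxRat.2, Format.E2M3_maxRat.2, Format.E3M2_maxRat.2]; norm_num

/-- EVERY `E2M1·E2M1` PRODUCT IS A LETTER of the E2M1 law (quarters). [cell, kernel: all 16² pairs] -/
theorem mul_mem_PiL_e2m1 (a b : MiniFloat Format.E2M1) : e2m1Law.PiL 2 (a.toRat * b.toRat) :=
  PiL_of_magTest _ _ quantum_pairs_e2m1.1 (by decide +kernel) a b

/-- EVERY `E2M3·E2M1` PRODUCT IS A LETTER of the E2M3×E2M1 law (grid `1/16`).
[cell, kernel: all 64·16 pairs] -/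
theorem mul_mem_PiL_e2m3e2m1 (a : MiniFloat Format.E2M3) (b : MiniFloat Format.E2M1) :
    e2m3e2m1Law.PiL 4 (a.toRat * b.toRat) :=
  PiL_of_magTest _ _ quantum_pairs_e2m1.2.1 (by decide +kernel) a b

/-- EVERY `E3M2·E2M1` PRODUCT IS A LETTER of the E3M2×E2M1 law (grid `1/32`).
[cell, kernel: all 64·16 pairs] -/
theorem mul_mem_PiL_e3m2e2m1 (a : MiniFloat Format.E3M2) (b : MiniFloat Format.E2M1) :
    e3m2e2m1Law.PiL 5 (a.toRat * b.toRat) :=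
  PiL_of_magTest _ _ quantum_pairs_e2m1.2.2 (by decide +kernel) a b

/-- binary32 satisfies the format hypotheses of all three generated certificates (`manBits = 23`,
`qexp ≤ -5`, `2^38 ≤ maxRat`). [cite: IEEE7542019, Table 3.5] -/
theorem Binary32_gen_hyps : Format.Binary32.manBits = 23 ∧ Format.Binary32.qexp ≤ -5 ∧
    (2 : ℚ) ^ (Format.Binary32.manBits + 15) ≤ Format.Binary32.maxRat := by
  refine ⟨rfl, by decide, ?_⟩
  rw [Format.Binary32_maxRat.1, show Format.Binary32.manBits = 23 from rfl]
  norm_num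

/-- THE LAWS' CONSTANTS AT `p = 24`: `θ`, `κ`, `ρ`, `β_pair` for E2M1², E2M3×E2M1, E3M2×E2M1.
[cell] -/
theorem lawConstants_Binary32 :
    e2m1Law.thetaL 23 = 13 * 2 ^ 17 + 1 / 4 ∧ e2m1Law.kappaL 23 = 1 / (13 * 2 ^ 17 + 1 / 4) ∧
    e2m1Law.rhoL = 7 / 2 ∧ e2m1Law.betaL = 23 / 2 ∧
    e2m3e2m1Law.thetaL 23 = 2009771 / 5 ∧ e2m3e2m1Law.kappaL 23 = 16 / 7864321 ∧
    e2m3e2m1Law.rhoL = 31 / 2 ∧ e2m3e2m1Law.betaL = 95 / 2 ∧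
    e3m2e2m1Law.thetaL 23 = 4259841 / 4 ∧ e3m2e2m1Law.kappaL 23 = 4 / 4259841 ∧
    e3m2e2m1Law.rhoL = 7 / 2 ∧ e3m2e2m1Law.betaL = 23 / 2 := by
  simp only [LawData.thetaL, LawData.kappaL, LawData.rhoL, LawData.betaL, LawData.Bj, LawData.Sj,
    e2m1Law, e2m3e2m1Law, e3m2e2m1Law]
  norm_num

/-- E2M3×E2M1 INTO binary32, SEQUENTIAL RNE, EVERY `n = m + 1`: the two-sided all-`n` envelope with
the law's constants (`lawConstants_Binary32`). [cell, gemm.tex Thm t:thetapmix + Prop. Θ(i)] -/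
theorem abs_dot_err_le_e2m3e2m1_Binary32 (a : ℕ → MiniFloat Format.E2M3)
    (b : ℕ → MiniFloat Format.E2M1) (m : ℕ) :
    |(seqSum Format.Binary32 (fun j => (a j).toRat * (b j).toRat) m).toRat
        - ∑ j ∈ range (m + 1), (a j).toRat * (b j).toRat|
      ≤ (1 - e2m3e2m1Law.thetaL 23 / (m + e2m3e2m1Law.thetaL 23 *
          (1 + (max e2m3e2m1Law.rhoL e2m3e2m1Law.betaL + e2m3e2m1Law.kappaL 23))))
          * ∑ j ∈ range (m + 1), |(a j).toRat * (b j).toRat| := by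
  obtain ⟨h1, h2, h3⟩ := Binary32_gen_hyps
  have hc := thetaCert_e2m3e2m1Law Format.Binary32 (by rw [h1]; norm_num) (le_trans h2 (by norm_num))
    (le_trans (by rw [h1]; norm_num) h3)
  rw [h1] at hc
  exact hc.abs_err_le (fun q hq => PiL_neg _ _ hq) _ (fun j => mul_mem_PiL_e2m3e2m1 (a j) (b j)) m

/-- E3M2×E2M1 INTO binary32, SEQUENTIAL RNE, EVERY `n = m + 1`: the two-sided all-`n` envelope with
the law's constants (`lawConstants_Binary32`). [cell, gemm.tex Thm t:thetapmix + Prop. Θ(i)] -/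
theorem abs_dot_err_le_e3m2e2m1_Binary32 (a : ℕ → MiniFloat Format.E3M2)
    (b : ℕ → MiniFloat Format.E2M1) (m : ℕ) :
    |(seqSum Format.Binary32 (fun j => (a j).toRat * (b j).toRat) m).toRat
        - ∑ j ∈ range (m + 1), (a j).toRat * (b j).toRat|
      ≤ (1 - e3m2e2m1Law.thetaL 23 / (m + e3m2e2m1Law.thetaL 23 *
          (1 + (max e3m2e2m1Law.rhoL e3m2e2m1Law.betaL + e3m2e2m1Law.kappaL 23))))
          * ∑ j ∈ range (m + 1), |(a j).toRat * (b j).toRat| := by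
  obtain ⟨h1, h2, h3⟩ := Binary32_gen_hyps
  have hc := thetaCert_e3m2e2m1Law Format.Binary32 (by rw [h1]; norm_num) h2 h3
  rw [h1] at hc
  exact hc.abs_err_le (fun q hq => PiL_neg _ _ hq) _ (fun j => mul_mem_PiL_e3m2e2m1 (a j) (b j)) m

/- CONSISTENCY CHECK (an `example`, deliberately not a declaration): E2M1² into binary32 from the
GENERATED certificate `thetaCert_e2m1Law` gives exactly gen 12's envelope
`abs_dot_err_le_E2M1_Binary32` (`1 - 13631490/(8n + 170393625)`, `GemmThetaLawE2M1.lean`). [cell] -/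
example (a b : ℕ → MiniFloat Format.E2M1) (m : ℕ) :
    |(seqSum Format.Binary32 (fun j => (a j).toRat * (b j).toRat) m).toRat
        - ∑ j ∈ range (m + 1), (a j).toRat * (b j).toRat|
      ≤ (1 - 13631490 / (8 * (m + 1 : ℚ) + 170393625))
          * ∑ j ∈ range (m + 1), |(a j).toRat * (b j).toRat| := by
  obtain ⟨h1, h2, h3⟩ := Binary32_gen_hyps
  have hc := thetaCert_e2m1Law Format.Binary32 (by rw [h1]; norm_num) (le_trans h2 (by norm_num))
    (le_trans (by rw [h1]; norm_num) h3)
  rw [h1] at hc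
  have h := hc.abs_err_le (fun q hq => PiL_neg _ _ hq) _ (fun j => mul_mem_PiL_e2m1 (a j) (b j)) m
  obtain ⟨e1, e2, e3, e4, -⟩ := lawConstants_Binary32
  rw [e1, e2, e3, e4] at h
  have key : (1 - (13 * 2 ^ 17 + 1 / 4 : ℚ) / (m + (13 * 2 ^ 17 + 1 / 4) *
      (1 + (max (7 / 2 : ℚ) (23 / 2) + 1 / (13 * 2 ^ 17 + 1 / 4)))))
      = 1 - 13631490 / (8 * (m + 1 : ℚ) + 170393625) := by
    rw [max_eq_right (by norm_num), sub_right_inj, div_eq_div_iff (by positivity) (by positivity)]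
    ring
  rw [key] at h
  exact h

end ThetaLaw

end MiniFloat

end Literature.ComputerArithmetic.FloatingPoint
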